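import Summits.CriticalPhenomena.PercolationContinuityZ3.Theorems.PercNearOneGluingNoHeavyLowerTailSahiE3ProductSections
import Mathlib.Tactic.Linarith
import Mathlib.Tactic.Ring
import Mathlib.Tactic.Positivity
import HarnessLib
import HarnessLib.Audit

/-!
# `NoHeavyLowerTail` (crux stmt-CriticalPhenomena-4575), Sahi programme P4: CYLINDER EXTENSION of a flow certificate

Support file (cell `prim-l12`, seat P4, generation 13; `--supports stmt-CriticalPhenomena-4575`).  No named facts, no sorries;
standard axioms; def-free.

A flow certificate with exact deliveries (the six conditions (R0), (F0), (F≤), (cap), (K) with equality, (pair) of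
`…SahiE3PatternCertificate.phi_nonneg_of_patternCertificate`, in the form used by `…SahiE3LroOrStep.cert_or_step`) for a slot
`G ⊆ Q` and a weight `ν_Q ≥ 0` satisfying Harris' inequality for up-sets is extended to the CYLINDER slot
`U = {(b, t) | t ∈ G}` of `B × Q` with the product weight `ν(b, t) = ν_B(b)·ν_Q(t)`, for ANY finite poset `B` with a weight
`ν_B ≥ 0` satisfying Harris' inequality for up-sets (THEOREM `cert_cylinder`).  The certificate acts fibrewise:
`R(b, t) = Z_B²·ν_B(b)·R_Q(t)`, `Fl((b, t), (b, s)) = Z_B²·ν_B(b)·Fl_Q(t, s)`.  The only non-trivial point is the pair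
inequality: for up-sets `S, S'` of `B × Q` with `Q`-sections `S_b = {t | (b,t) ∈ S}`, the need splits as
`Z_B·Σ_{b,b'} ν_B(b)ν_B(b')·need_Q(S_b, S'_{b'})`, each term is bounded by `R_Q(S_b ∩ S'_{b'} ∩ G)` (pair inequality on `Q` for
the CROSS pair of sections — both are up-sets of `Q`), and `Σ_{t∈G} R_Q(t)·ν_B{b | t ∈ S_b}·ν_B{b' | t ∈ S'_{b'}}` is folded by
Harris on `B` applied to the `B`-sections `{b | (b,t) ∈ S}` (up-sets of `B`), using `R_Q ≥ 0`.  The same interchange proves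
Harris' inequality for the product weight (`harris_prod`).  This is the "irrelevant coordinates" step at the PATTERN level
(the layer-`0` slot of the block OR-step, HOME memo prim-l12/FROM-prim-l12-p4-gen13-BLOCK-OR-STEP.md); so far irrelevant
coordinates were only available as kernel fibres.
-/

namespace Summit.CriticalPhenomena.PercolationContinuityZ3.Theorems.SahiE3CertCylinder

open Finset SahiE3ProductSections
open scoped BigOperators

variable {B Q : Type*} [Fintype B] [DecidableEq B] [PartialOrder B] [Fintype Q] [DecidableEq Q] [PartialOrder Q]

/-! ### The cylinder extension -/

/-- **Cylinder extension of a flow certificate.**  Let `ν_Q ≥ 0` on a finite poset `Q` satisfy Harris for up-sets and let the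
up-set `G ⊆ Q` carry a flow certificate `(R_Q, Fl_Q)` with exact deliveries.  Let `B` be any finite poset with a weight
`ν_B ≥ 0` satisfying Harris for up-sets.  Then the cylinder `U = {(b,t) | t ∈ G}` of `B × Q` with the product weight is an up-set,
the product weight satisfies Harris, and `U` carries a flow certificate with exact deliveries (`R(b,t) = Z_B² ν_B(b) R_Q(t)`,
fibrewise flows). [this work] -/
theorem cert_cylinder {νB : B → ℝ} {νQ : Q → ℝ} (hνB : ∀ b, 0 ≤ νB b) (hνQ : ∀ t, 0 ≤ νQ t)
    (hHB : ∀ S S' : Finset B, IsUpperSet (S : Set B) → IsUpperSet (S' : Set B) →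
      (∑ t ∈ S, νB t) * (∑ t ∈ S', νB t) ≤ (∑ t, νB t) * ∑ t ∈ S ∩ S', νB t)
    (hHQ : ∀ S S' : Finset Q, IsUpperSet (S : Set Q) → IsUpperSet (S' : Set Q) →
      (∑ t ∈ S, νQ t) * (∑ t ∈ S', νQ t) ≤ (∑ t, νQ t) * ∑ t ∈ S ∩ S', νQ t)
    (G : Finset Q) (hG : IsUpperSet (G : Set Q)) (RQ : Q → ℝ) (FlQ : Q → Q → ℝ)
    (g1 : ∀ t ∈ G, 0 ≤ RQ t) (g2 : ∀ t s, 0 ≤ FlQ t s) (g3 : ∀ t s, FlQ t s ≠ 0 → s ≤ t)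
    (g4 : ∀ t ∈ G, RQ t + ∑ s ∈ Gᶜ, FlQ t s ≤ (∑ r, νQ r) * ((∑ r, νQ r) + ∑ r ∈ Gᶜ, νQ r) * νQ t)
    (g5 : ∀ s ∈ Gᶜ, ∑ t ∈ G, FlQ t s = (∑ r, νQ r) * (∑ r ∈ G, νQ r) * νQ s)
    (g6 : ∀ S S' : Finset Q, IsUpperSet (S : Set Q) → IsUpperSet (S' : Set Q) →
      (∑ r, νQ r) * ((∑ t ∈ S, νQ t) * (∑ t ∈ S' ∩ G, νQ t) + (∑ t ∈ S', νQ t) * (∑ t ∈ S ∩ G, νQ t))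
          - (∑ r ∈ G, νQ r) * (∑ t ∈ S, νQ t) * (∑ t ∈ S', νQ t) ≤ ∑ t ∈ (S ∩ S') ∩ G, RQ t)
    (ν : B × Q → ℝ) (hν : ∀ x, ν x = νB x.1 * νQ x.2)
    (U : Finset (B × Q)) (hU : ∀ x, x ∈ U ↔ x.2 ∈ G) :
    IsUpperSet (U : Set (B × Q)) ∧
    (∀ S S' : Finset (B × Q), IsUpperSet (S : Set (B × Q)) → IsUpperSet (S' : Set (B × Q)) →
      (∑ t ∈ S, ν t) * (∑ t ∈ S', ν t) ≤ (∑ t, ν t) * ∑ t ∈ S ∩ S', ν t) ∧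
    ∃ (R : B × Q → ℝ) (Fl : (B × Q) → (B × Q) → ℝ),
      (∀ t ∈ U, 0 ≤ R t) ∧ (∀ t s, 0 ≤ Fl t s) ∧ (∀ t s, Fl t s ≠ 0 → s ≤ t) ∧
      (∀ t ∈ U, R t + ∑ s ∈ Uᶜ, Fl t s ≤ (∑ r, ν r) * ((∑ r, ν r) + ∑ r ∈ Uᶜ, ν r) * ν t) ∧
      (∀ s ∈ Uᶜ, ∑ t ∈ U, Fl t s = (∑ r, ν r) * (∑ r ∈ U, ν r) * ν s) ∧
      (∀ S S' : Finset (B × Q), IsUpperSet (S : Set (B × Q)) → IsUpperSet (S' : Set (B × Q)) →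
        (∑ r, ν r) * ((∑ t ∈ S, ν t) * (∑ t ∈ S' ∩ U, ν t) + (∑ t ∈ S', ν t) * (∑ t ∈ S ∩ U, ν t))
            - (∑ r ∈ U, ν r) * (∑ t ∈ S, ν t) * (∑ t ∈ S', ν t) ≤ ∑ t ∈ (S ∩ S') ∩ U, R t) := by
  -- basic masses (kept as explicit sums; abbreviations only in comments: ZB, ZQ, NG, ND)
  have hZB0 : 0 ≤ ∑ b, νB b := Finset.sum_nonneg fun b _ => hνB b
  have secU : ∀ b, univ.filter (fun t => (b, t) ∈ U) = G := fun b => by ext t; simp [hU]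
  have secUc : ∀ b, univ.filter (fun t => (b, t) ∈ Uᶜ) = Gᶜ := fun b => by ext t; simp [hU]
  have eZ : ∑ x, ν x = (∑ b, νB b) * ∑ t, νQ t := by
    rw [show (∑ x, ν x) = ∑ x : B × Q, νB x.1 * νQ x.2 from Finset.sum_congr rfl fun x _ => hν x,
      Finset.sum_mul_sum, ← Finset.univ_product_univ, Finset.sum_product]
  have eNU : ∑ x ∈ U, ν x = (∑ b, νB b) * ∑ t ∈ G, νQ t := by
    rw [sum_sectionsQ, Finset.sum_mul]
    refine Finset.sum_congr rfl fun b _ => ?_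
    rw [secU, Finset.mul_sum]
    exact Finset.sum_congr rfl fun t _ => hν (b, t)
  have eND : ∑ x ∈ Uᶜ, ν x = (∑ b, νB b) * ∑ t ∈ Gᶜ, νQ t := by
    rw [sum_sectionsQ, Finset.sum_mul]
    refine Finset.sum_congr rfl fun b _ => ?_
    rw [secUc, Finset.mul_sum]
    exact Finset.sum_congr rfl fun t _ => hν (b, t)
  have hUup : IsUpperSet (U : Set (B × Q)) := by
    intro x y hxy hx
    simp only [Finset.mem_coe, hU] at hx ⊢
    exact hG (Prod.mk_le_mk.1 hxy).2 hx
  refine ⟨hUup, harris_prod hνB hνQ hHB hHQ ν hν, ?_⟩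
  -- the certificate
  refine ⟨fun x => (∑ b, νB b) ^ 2 * νB x.1 * RQ x.2,
    fun x y => if x.1 = y.1 then (∑ b, νB b) ^ 2 * νB x.1 * FlQ x.2 y.2 else 0, ?_, ?_, ?_, ?_, ?_, ?_⟩
  · -- (R0)
    intro x hx
    exact mul_nonneg (mul_nonneg (pow_nonneg hZB0 2) (hνB _)) (g1 _ ((hU x).1 hx))
  · -- (F0)
    intro x y
    show 0 ≤ (if x.1 = y.1 then (∑ b, νB b) ^ 2 * νB x.1 * FlQ x.2 y.2 else 0)
    by_cases h : x.1 = y.1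
    · rw [if_pos h]; exact mul_nonneg (mul_nonneg (pow_nonneg hZB0 2) (hνB _)) (g2 _ _)
    · rw [if_neg h]
  · -- (F≤)
    intro x y h
    have h' : (if x.1 = y.1 then (∑ b, νB b) ^ 2 * νB x.1 * FlQ x.2 y.2 else 0) ≠ 0 := h
    by_cases h1 : x.1 = y.1
    · rw [if_pos h1] at h'
      have h2 : FlQ x.2 y.2 ≠ 0 := by
        intro h0; apply h'; rw [h0, mul_zero]
      exact Prod.le_def.2 ⟨le_of_eq h1.symm, g3 _ _ h2⟩
    · rw [if_neg h1] at h'; exact absurd rfl h'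
  · -- (cap)
    rintro ⟨b, t⟩ hx
    have ht : t ∈ G := (hU (b, t)).1 hx
    show (∑ b, νB b) ^ 2 * νB b * RQ t +
        ∑ y ∈ Uᶜ, (if b = y.1 then (∑ b, νB b) ^ 2 * νB b * FlQ t y.2 else 0) ≤
        (∑ r, ν r) * ((∑ r, ν r) + ∑ r ∈ Uᶜ, ν r) * ν (b, t)
    have hout : ∑ y ∈ Uᶜ, (if b = y.1 then (∑ b, νB b) ^ 2 * νB b * FlQ t y.2 else 0)
        = (∑ b, νB b) ^ 2 * νB b * ∑ s ∈ Gᶜ, FlQ t s := by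
      rw [sum_sectionsQ]
      have inner : ∀ b', ∑ s ∈ univ.filter (fun s => (b', s) ∈ Uᶜ),
          (if b = ((b', s) : B × Q).1 then (∑ b, νB b) ^ 2 * νB b * FlQ t ((b', s) : B × Q).2 else 0)
          = if b = b' then (∑ b, νB b) ^ 2 * νB b * ∑ s ∈ Gᶜ, FlQ t s else 0 := by
        intro b'
        rw [secUc]
        by_cases h : b = b'
        · simp only [h, ↓reduceIte, Finset.mul_sum]
        · simp only [h, ↓reduceIte, Finset.sum_const_zero]
      rw [Finset.sum_congr rfl fun b' _ => inner b', Finset.sum_ite_eq univ b, if_pos (Finset.mem_univ b)]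
    rw [hout, eZ, eND, hν]
    have hcap := g4 t ht
    have hb : 0 ≤ (∑ b, νB b) ^ 2 * νB b := mul_nonneg (pow_nonneg hZB0 2) (hνB b)
    calc (∑ b, νB b) ^ 2 * νB b * RQ t + (∑ b, νB b) ^ 2 * νB b * ∑ s ∈ Gᶜ, FlQ t s
        = (∑ b, νB b) ^ 2 * νB b * (RQ t + ∑ s ∈ Gᶜ, FlQ t s) := by ring
      _ ≤ (∑ b, νB b) ^ 2 * νB b * ((∑ r, νQ r) * ((∑ r, νQ r) + ∑ r ∈ Gᶜ, νQ r) * νQ t) :=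
          mul_le_mul_of_nonneg_left hcap hb
      _ = (∑ b, νB b) * (∑ t, νQ t) * ((∑ b, νB b) * (∑ t, νQ t) + (∑ b, νB b) * ∑ t ∈ Gᶜ, νQ t) *
            (νB ((b, t) : B × Q).1 * νQ ((b, t) : B × Q).2) := by simp only; ring
  · -- (K)
    rintro ⟨b', s⟩ hy
    have hs : s ∈ Gᶜ := by
      rw [Finset.mem_compl] at hy ⊢; exact fun h => hy ((hU (b', s)).2 h)
    show ∑ x ∈ U, (if x.1 = b' then (∑ b, νB b) ^ 2 * νB x.1 * FlQ x.2 s else 0) =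
        (∑ r, ν r) * (∑ r ∈ U, ν r) * ν (b', s)
    have hin : ∑ x ∈ U, (if x.1 = b' then (∑ b, νB b) ^ 2 * νB x.1 * FlQ x.2 s else 0)
        = (∑ b, νB b) ^ 2 * νB b' * ∑ t ∈ G, FlQ t s := by
      rw [sum_sectionsQ]
      have inner : ∀ b, ∑ t ∈ univ.filter (fun t => (b, t) ∈ U),
          (if ((b, t) : B × Q).1 = b' then (∑ b, νB b) ^ 2 * νB ((b, t) : B × Q).1 * FlQ ((b, t) : B × Q).2 s else 0)
          = if b = b' then (∑ b, νB b) ^ 2 * νB b' * ∑ t ∈ G, FlQ t s else 0 := by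
        intro b
        rw [secU]
        by_cases h : b = b'
        · simp only [h, ↓reduceIte, Finset.mul_sum]
        · simp only [h, ↓reduceIte, Finset.sum_const_zero]
      rw [Finset.sum_congr rfl fun b _ => inner b, Finset.sum_ite_eq' univ b', if_pos (Finset.mem_univ b')]
    rw [hin, g5 s hs, eZ, eNU, hν]
    simp only
    ring
  · -- (pair)
    intro S S' hS hS'
    show (∑ r, ν r) * ((∑ t ∈ S, ν t) * (∑ t ∈ S' ∩ U, ν t) + (∑ t ∈ S', ν t) * (∑ t ∈ S ∩ U, ν t))
        - (∑ r ∈ U, ν r) * (∑ t ∈ S, ν t) * (∑ t ∈ S', ν t) ≤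
        ∑ x ∈ (S ∩ S') ∩ U, (∑ b, νB b) ^ 2 * νB x.1 * RQ x.2
    -- sections: xs b = ν_Q(S_b), xg b = ν_Q(S_b ∩ G), and primed versions
    have eS : ∑ x ∈ S, ν x = ∑ b, νB b * ∑ t ∈ univ.filter (fun t => (b, t) ∈ S), νQ t := by
      rw [sum_sectionsQ]; refine Finset.sum_congr rfl fun b _ => ?_; rw [Finset.mul_sum]
      exact Finset.sum_congr rfl fun t _ => hν (b, t)
    have eS' : ∑ x ∈ S', ν x = ∑ b, νB b * ∑ t ∈ univ.filter (fun t => (b, t) ∈ S'), νQ t := by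
      rw [sum_sectionsQ]; refine Finset.sum_congr rfl fun b _ => ?_; rw [Finset.mul_sum]
      exact Finset.sum_congr rfl fun t _ => hν (b, t)
    have eSU : ∑ x ∈ S ∩ U, ν x = ∑ b, νB b * ∑ t ∈ univ.filter (fun t => (b, t) ∈ S) ∩ G, νQ t := by
      rw [sum_sectionsQ]; refine Finset.sum_congr rfl fun b _ => ?_; rw [secQ_inter, secU, Finset.mul_sum]
      exact Finset.sum_congr rfl fun t _ => hν (b, t)
    have eS'U : ∑ x ∈ S' ∩ U, ν x = ∑ b, νB b * ∑ t ∈ univ.filter (fun t => (b, t) ∈ S') ∩ G, νQ t := by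
      rw [sum_sectionsQ]; refine Finset.sum_congr rfl fun b _ => ?_; rw [secQ_inter, secU, Finset.mul_sum]
      exact Finset.sum_congr rfl fun t _ => hν (b, t)
    -- the R-mass of `S ∩ S' ∩ U` by B-sections
    have eR : ∑ x ∈ (S ∩ S') ∩ U, (∑ b, νB b) ^ 2 * νB x.1 * RQ x.2 =
        ∑ t, (if t ∈ G then RQ t else 0) * ((∑ b, νB b) ^ 2 * ∑ b ∈ univ.filter (fun b => (b, t) ∈ S ∩ S'), νB b) := by
      rw [sum_sectionsB]
      refine Finset.sum_congr rfl fun t _ => ?_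
      by_cases ht : t ∈ G
      · have hsec : univ.filter (fun b => (b, t) ∈ (S ∩ S') ∩ U) = univ.filter (fun b => (b, t) ∈ S ∩ S') := by
          ext b; simp [hU, ht]
        rw [hsec, if_pos ht, Finset.mul_sum, Finset.mul_sum]
        exact Finset.sum_congr rfl fun b _ => by simp only; ring
      · have hsec : univ.filter (fun b => (b, t) ∈ (S ∩ S') ∩ U) = ∅ := by
          ext b; simp [hU, ht]
        rw [hsec, if_neg ht, Finset.sum_empty, zero_mul]
    -- step 1: the need splits over pairs of sections and each term is bounded by the pair inequality on `Q`
    have hP1 : (∑ b, νB b * ∑ t ∈ univ.filter (fun t => (b, t) ∈ S), νQ t) *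
        (∑ b, νB b * ∑ t ∈ univ.filter (fun t => (b, t) ∈ S') ∩ G, νQ t) =
        ∑ b, ∑ b', (νB b * ∑ t ∈ univ.filter (fun t => (b, t) ∈ S), νQ t) *
          (νB b' * ∑ t ∈ univ.filter (fun t => (b', t) ∈ S') ∩ G, νQ t) := Finset.sum_mul_sum _ _ _ _
    have hP2 : (∑ b, νB b * ∑ t ∈ univ.filter (fun t => (b, t) ∈ S'), νQ t) *
        (∑ b, νB b * ∑ t ∈ univ.filter (fun t => (b, t) ∈ S) ∩ G, νQ t) =
        ∑ b, ∑ b', (νB b' * ∑ t ∈ univ.filter (fun t => (b', t) ∈ S'), νQ t) *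
          (νB b * ∑ t ∈ univ.filter (fun t => (b, t) ∈ S) ∩ G, νQ t) := by
      rw [Finset.sum_mul_sum, Finset.sum_comm]
    have hP3 : (∑ b, νB b * ∑ t ∈ univ.filter (fun t => (b, t) ∈ S), νQ t) *
        (∑ b, νB b * ∑ t ∈ univ.filter (fun t => (b, t) ∈ S'), νQ t) =
        ∑ b, ∑ b', (νB b * ∑ t ∈ univ.filter (fun t => (b, t) ∈ S), νQ t) *
          (νB b' * ∑ t ∈ univ.filter (fun t => (b', t) ∈ S'), νQ t) := Finset.sum_mul_sum _ _ _ _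
    have step1 : (∑ r, ν r) * ((∑ t ∈ S, ν t) * (∑ t ∈ S' ∩ U, ν t) + (∑ t ∈ S', ν t) * (∑ t ∈ S ∩ U, ν t))
        - (∑ r ∈ U, ν r) * (∑ t ∈ S, ν t) * (∑ t ∈ S', ν t) ≤
        (∑ b, νB b) * ∑ b, ∑ b', νB b * νB b' *
          ∑ t ∈ univ.filter (fun t => (b, t) ∈ S) ∩ univ.filter (fun t => (b', t) ∈ S'), (if t ∈ G then RQ t else 0) := by
      -- rewrite the left side as `Z_B · ΣΣ ν_B(b) ν_B(b') need_Q(S_b, S'_b')`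
      have expand : (∑ r, ν r) * ((∑ t ∈ S, ν t) * (∑ t ∈ S' ∩ U, ν t) + (∑ t ∈ S', ν t) * (∑ t ∈ S ∩ U, ν t))
          - (∑ r ∈ U, ν r) * (∑ t ∈ S, ν t) * (∑ t ∈ S', ν t) =
          (∑ b, νB b) * ∑ b, ∑ b', νB b * νB b' *
            ((∑ r, νQ r) * ((∑ t ∈ univ.filter (fun t => (b, t) ∈ S), νQ t) *
                (∑ t ∈ univ.filter (fun t => (b', t) ∈ S') ∩ G, νQ t) +
              (∑ t ∈ univ.filter (fun t => (b', t) ∈ S'), νQ t) *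
                (∑ t ∈ univ.filter (fun t => (b, t) ∈ S) ∩ G, νQ t))
              - (∑ r ∈ G, νQ r) * (∑ t ∈ univ.filter (fun t => (b, t) ∈ S), νQ t) *
                (∑ t ∈ univ.filter (fun t => (b', t) ∈ S'), νQ t)) := by
        have hsplit : ∀ b b', νB b * νB b' *
            ((∑ r, νQ r) * ((∑ t ∈ univ.filter (fun t => (b, t) ∈ S), νQ t) *
                (∑ t ∈ univ.filter (fun t => (b', t) ∈ S') ∩ G, νQ t) +
              (∑ t ∈ univ.filter (fun t => (b', t) ∈ S'), νQ t) *
                (∑ t ∈ univ.filter (fun t => (b, t) ∈ S) ∩ G, νQ t))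
              - (∑ r ∈ G, νQ r) * (∑ t ∈ univ.filter (fun t => (b, t) ∈ S), νQ t) *
                (∑ t ∈ univ.filter (fun t => (b', t) ∈ S'), νQ t)) =
            (∑ r, νQ r) * ((νB b * ∑ t ∈ univ.filter (fun t => (b, t) ∈ S), νQ t) *
                (νB b' * ∑ t ∈ univ.filter (fun t => (b', t) ∈ S') ∩ G, νQ t))
            + (∑ r, νQ r) * ((νB b' * ∑ t ∈ univ.filter (fun t => (b', t) ∈ S'), νQ t) *
                (νB b * ∑ t ∈ univ.filter (fun t => (b, t) ∈ S) ∩ G, νQ t))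
            - (∑ r ∈ G, νQ r) * ((νB b * ∑ t ∈ univ.filter (fun t => (b, t) ∈ S), νQ t) *
                (νB b' * ∑ t ∈ univ.filter (fun t => (b', t) ∈ S'), νQ t)) := by
          intro b b'; ring
        rw [Finset.sum_congr rfl fun b _ => Finset.sum_congr rfl fun b' _ => hsplit b b']
        simp only [Finset.sum_sub_distrib, Finset.sum_add_distrib]
        rw [dsum_mul, dsum_mul, dsum_mul, ← hP1, ← hP2, ← hP3, eZ, eNU, eS, eS', eSU, eS'U]
        ring
      rw [expand]
      refine mul_le_mul_of_nonneg_left ?_ hZB0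
      refine Finset.sum_le_sum fun b _ => Finset.sum_le_sum fun b' _ => ?_
      refine mul_le_mul_of_nonneg_left ?_ (mul_nonneg (hνB b) (hνB b'))
      have h := g6 _ _ (isUpperSet_secQ hS b) (isUpperSet_secQ hS' b')
      have hrw : ∑ t ∈ (univ.filter (fun t => (b, t) ∈ S) ∩ univ.filter (fun t => (b', t) ∈ S')) ∩ G, RQ t =
          ∑ t ∈ univ.filter (fun t => (b, t) ∈ S) ∩ univ.filter (fun t => (b', t) ∈ S'), (if t ∈ G then RQ t else 0) := by
        rw [← Finset.filter_mem_eq_inter, Finset.sum_filter]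
      rw [hrw] at h
      exact h
    -- step 2: interchange, then Harris on `B` for the `B`-sections, for every `t ∈ G`
    rw [sum_sections_interchange] at step1
    have step2 : ∑ t, (if t ∈ G then RQ t else 0) * (∑ b ∈ univ.filter (fun b => (b, t) ∈ S), νB b) *
          (∑ b' ∈ univ.filter (fun b' => (b', t) ∈ S'), νB b')
        ≤ ∑ t, (if t ∈ G then RQ t else 0) * ((∑ b, νB b) * ∑ b ∈ univ.filter (fun b => (b, t) ∈ S ∩ S'), νB b) := by
      refine Finset.sum_le_sum fun t _ => ?_
      rw [mul_assoc, secB_inter]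
      refine mul_le_mul_of_nonneg_left (hHB _ _ (isUpperSet_secB hS t) (isUpperSet_secB hS' t)) ?_
      by_cases ht : t ∈ G
      · rw [if_pos ht]; exact g1 t ht
      · rw [if_neg ht]
    calc (∑ r, ν r) * ((∑ t ∈ S, ν t) * (∑ t ∈ S' ∩ U, ν t) + (∑ t ∈ S', ν t) * (∑ t ∈ S ∩ U, ν t))
          - (∑ r ∈ U, ν r) * (∑ t ∈ S, ν t) * (∑ t ∈ S', ν t)
        ≤ (∑ b, νB b) * ∑ t, (if t ∈ G then RQ t else 0) * (∑ b ∈ univ.filter (fun b => (b, t) ∈ S), νB b) *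
            (∑ b' ∈ univ.filter (fun b' => (b', t) ∈ S'), νB b') := step1
      _ ≤ (∑ b, νB b) * ∑ t, (if t ∈ G then RQ t else 0) *
            ((∑ b, νB b) * ∑ b ∈ univ.filter (fun b => (b, t) ∈ S ∩ S'), νB b) :=
            mul_le_mul_of_nonneg_left step2 hZB0
      _ = ∑ x ∈ (S ∩ S') ∩ U, (∑ b, νB b) ^ 2 * νB x.1 * RQ x.2 := by
            rw [eR, Finset.mul_sum]
            refine Finset.sum_congr rfl fun t _ => ?_
            ring

end Summit.CriticalPhenomena.PercolationContinuityZ3.Theorems.SahiE3CertCylinder
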